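import Literature.Computability.AlgebraicComplexity.InterfaceTensors
import HarnessLib

/-!
# Shifting the target split distributions of an `ε`-interface tensor costs the shift in `ε`
(Vassilevska Williams–Xu–Xu–Zhou 2024, proof of Thm. 6.3: "the `ε`-interface tensor with complete split
distributions `{ξ_{W,t}}` is contained in the `3ε`-interface tensor with `{β_{W,t}}` as a subtensor")
— proved

Topic `Literature/Computability/AlgebraicComplexity`.  In the proof of Theorem 6.3 of Vassilevska
Williams–Xu–Xu–Zhou (SODA 2024, arXiv:2307.07970, §6, p. 26–27) the input copies are `3ε`-interface
tensors with targets `β_{W,t}`, while Prop. 6.2 is applied to `ε`-interface tensors with targets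
`ξ_{W,t}` at `L_∞`-distance `≤ 2ε` from `β_{W,t}`; the latter is a sub-tensor (zero-out) of the former
by the triangle inequality.  This file PROVES the general statement for the tree's `interfaceTensor`:

* `admissibleSeqs_subset_of_close`, `levelBlocksX/Y/Z_subset_of_close` — if two parameter lists have
  the same constituent indices and split distributions at `L_∞`-distance `≤ δ` term by term, every
  level-1 block `ε`-admissible for the first is `(ε + δ)`-admissible for the second;
* `interfaceTensor_eq_partSubtensor_of_close`, `tensorRestrictsTo_interfaceTensor_of_close` —
  **`𝒯_{τ,L,ε+δ} ≥ 𝒯_{τ,L',ε}`** (a zero-out, hence a degeneration), and the same for `k` copies.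

Everything is proved; no definitions; no named facts.

## References

* V. Vassilevska Williams, Y. Xu, Z. Xu, R. Zhou, *New bounds for matrix multiplication: from alpha
  to omega*, SODA 2024, arXiv:2307.07970 (held: `paper:arxiv-2307.07970`), Thm. 6.3 (proof, last
  paragraph) and Def. 3.6. [VassilevskaWilliamsXuXuZhou2024]
-/

noncomputable section

open scoped BigOperators
open Finset

namespace Literature.Computability.AlgebraicComplexity

open Literature.Barriers.MatrixMultiplication (bigCwTensor)

universe u

section Shift

variable {c n s : ℕ} (τ : Fin n → Fin s)

/-- **Triangle inequality for admissibility**: `ε`-consistent with `γ'` and `‖γ' − γ‖_∞ ≤ δ` give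
`(ε+δ)`-consistent with `γ`. [cite: VassilevskaWilliamsXuXuZhou2024, Thm. 6.3 (proof: "contained in the 3ε-interface tensor … as a subtensor")] -/
theorem admissibleSeqs_subset_of_close (deg : Fin s → ℕ) {γ γ' : Fin s → (Fin c → Fin 3) → ℝ} {ε δ : ℝ}
    (hclose : ∀ t σ, |γ' t σ - γ t σ| ≤ δ) : admissibleSeqs τ deg γ' ε ⊆ admissibleSeqs τ deg γ (ε + δ) := by
  intro I hI
  rw [mem_admissibleSeqs] at hI ⊢
  refine ⟨hI.1, fun t hne σ => ?_⟩
  have h1 := hI.2 t hne σ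
  have h2 := hclose t σ
  calc |completeSplitOn I (univ.filter fun u => τ u = t) σ - γ t σ|
      = |(completeSplitOn I (univ.filter fun u => τ u = t) σ - γ' t σ) + (γ' t σ - γ t σ)| := by ring_nf
    _ ≤ |completeSplitOn I (univ.filter fun u => τ u = t) σ - γ' t σ| + |γ' t σ - γ t σ| := abs_add_le _ _
    _ ≤ ε + δ := add_le_add h1 h2

variable {L L' : Fin s → InterfaceTerm c} {ε δ : ℝ}

/-- `X`-blocks: `ε`-admissible for `L'` ⇒ `(ε+δ)`-admissible for `L`. [cite: VassilevskaWilliamsXuXuZhou2024, Thm. 6.3 (proof)] -/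
theorem levelBlocksX_subset_of_close (hi : ∀ t, (L' t).i = (L t).i) (hX : ∀ t σ, |(L' t).γX σ - (L t).γX σ| ≤ δ) :
    levelBlocksX τ L' ε ⊆ levelBlocksX τ L (ε + δ) := by
  have h := admissibleSeqs_subset_of_close τ (fun t => (L t).i) (γ := fun t => (L t).γX) (γ' := fun t => (L' t).γX)
    (ε := ε) hX
  have e : (fun t => (L' t).i) = fun t => (L t).i := funext hi
  unfold levelBlocksX
  rw [e]
  exact h

/-- `Y`-blocks: `ε`-admissible for `L'` ⇒ `(ε+δ)`-admissible for `L`. [cite: VassilevskaWilliamsXuXuZhou2024, Thm. 6.3 (proof)] -/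
theorem levelBlocksY_subset_of_close (hj : ∀ t, (L' t).j = (L t).j) (hY : ∀ t σ, |(L' t).γY σ - (L t).γY σ| ≤ δ) :
    levelBlocksY τ L' ε ⊆ levelBlocksY τ L (ε + δ) := by
  have h := admissibleSeqs_subset_of_close τ (fun t => (L t).j) (γ := fun t => (L t).γY) (γ' := fun t => (L' t).γY)
    (ε := ε) hY
  have e : (fun t => (L' t).j) = fun t => (L t).j := funext hj
  unfold levelBlocksY
  rw [e]
  exact h

/-- `Z`-blocks: `ε`-admissible for `L'` ⇒ `(ε+δ)`-admissible for `L`. [cite: VassilevskaWilliamsXuXuZhou2024, Thm. 6.3 (proof)] -/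
theorem levelBlocksZ_subset_of_close (hk : ∀ t, (L' t).k = (L t).k) (hZ : ∀ t σ, |(L' t).γZ σ - (L t).γZ σ| ≤ δ) :
    levelBlocksZ τ L' ε ⊆ levelBlocksZ τ L (ε + δ) := by
  have h := admissibleSeqs_subset_of_close τ (fun t => (L t).k) (γ := fun t => (L t).γZ) (γ' := fun t => (L' t).γZ)
    (ε := ε) hZ
  have e : (fun t => (L' t).k) = fun t => (L t).k := funext hk
  unfold levelBlocksZ
  rw [e]
  exact h

variable (K : Type u) [CommSemiring K] (q : ℕ)

/-- **The `ε`-interface tensor of the shifted targets is a zero-out of the `(ε+δ)`-interface tensor.**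
[cite: VassilevskaWilliamsXuXuZhou2024, Thm. 6.3 (proof, last paragraph)] -/
theorem interfaceTensor_eq_partSubtensor_of_close (hi : ∀ t, (L' t).i = (L t).i) (hj : ∀ t, (L' t).j = (L t).j)
    (hk : ∀ t, (L' t).k = (L t).k) (hX : ∀ t σ, |(L' t).γX σ - (L t).γX σ| ≤ δ)
    (hY : ∀ t σ, |(L' t).γY σ - (L t).γY σ| ≤ δ) (hZ : ∀ t σ, |(L' t).γZ σ - (L t).γZ σ| ≤ δ) :
    interfaceTensor K q τ L' ε =
      partSubtensor levelSeq levelSeq levelSeq (interfaceTensor K q τ L (ε + δ))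
        (levelBlocksX τ L' ε) (levelBlocksY τ L' ε) (levelBlocksZ τ L' ε) := by
  rw [interfaceTensor, interfaceTensor, partSubtensor_partSubtensor,
    inter_eq_right.2 (levelBlocksX_subset_of_close τ hi hX), inter_eq_right.2 (levelBlocksY_subset_of_close τ hj hY),
    inter_eq_right.2 (levelBlocksZ_subset_of_close τ hk hZ)]

/-- **`𝒯_{τ,L,ε+δ} ≥ 𝒯_{τ,L',ε}`** for parameter lists with the same constituent indices and split
distributions at `L_∞`-distance `≤ δ` (VXXZ: `δ = 2ε`, "the `ε`-interface tensor with `{ξ_{W,t}}` is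
contained in the `3ε`-interface tensor with `{β_{W,t}}` as a subtensor"). [cite: VassilevskaWilliamsXuXuZhou2024, Thm. 6.3 (proof)] -/
theorem tensorRestrictsTo_interfaceTensor_of_close (hi : ∀ t, (L' t).i = (L t).i) (hj : ∀ t, (L' t).j = (L t).j)
    (hk : ∀ t, (L' t).k = (L t).k) (hX : ∀ t σ, |(L' t).γX σ - (L t).γX σ| ≤ δ)
    (hY : ∀ t σ, |(L' t).γY σ - (L t).γY σ| ≤ δ) (hZ : ∀ t σ, |(L' t).γZ σ - (L t).γZ σ| ≤ δ) :
    TensorRestrictsTo (interfaceTensor K q τ L (ε + δ)) (interfaceTensor K q τ L' ε) := by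
  rw [interfaceTensor_eq_partSubtensor_of_close τ K q hi hj hk hX hY hZ]
  exact tensorRestrictsTo_partSubtensor _ _ _ _ _ _ _

/-- The same for `k` independent copies. [cite: VassilevskaWilliamsXuXuZhou2024, Thm. 6.3 (proof)] -/
theorem tensorRestrictsTo_copies_interfaceTensor_of_close (m : ℕ) (hi : ∀ t, (L' t).i = (L t).i) (hj : ∀ t, (L' t).j = (L t).j)
    (hk : ∀ t, (L' t).k = (L t).k) (hX : ∀ t σ, |(L' t).γX σ - (L t).γX σ| ≤ δ)
    (hY : ∀ t σ, |(L' t).γY σ - (L t).γY σ| ≤ δ) (hZ : ∀ t σ, |(L' t).γZ σ - (L t).γZ σ| ≤ δ) :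
    TensorRestrictsTo (kroneckerTensor (unitTensor K m) (interfaceTensor K q τ L (ε + δ)))
      (kroneckerTensor (unitTensor K m) (interfaceTensor K q τ L' ε)) :=
  TensorRestrictsTo.kronecker (TensorRestrictsTo.refl _) (tensorRestrictsTo_interfaceTensor_of_close τ K q hi hj hk hX hY hZ)

end Shift

end Literature.Computability.AlgebraicComplexity
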